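import Summits.QuantumFields.YangMills.Theorems.BalabanUVNodesN12AtTheta13OfThm1CCMWGenericDoorTopLevel
import Summits.QuantumFields.YangMills.Theorems.BalabanUVNodesN12AtTheta13OfThm1CCMWGenericDoorV19Window
import Summits.QuantumFields.YangMills.Theorems.BalabanUVNodesN24K1ConsequentOfStubsV19AndChildren

/-!
# BalabanUVNodes ∕ N12 — THE WINDOW-GUARDED N12 FAMILY FOR THE K1⁸ CLOSER OF RECORD: the [IV] leaf owed ONLY on runs inside a window `]0, γ₁₂]` of N12's choosing,
# `∃ γ₁₂ > 0, ∃ lamW, ∀ P, lamW.kSel P < P.K → Step.InInterval γ₁₂ P.K (gOfRecord₁₃ F 2 θW P) → B15Leaf (WOfRecord₁₃ F 2 θW lamW P)` (this seat's ASK-2 ∕ LOCATED-H12-W to dag-n24-w1 ∕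
# dag-n24-c's successor, 2026-08-28T09:3xZ) — §1 on the RAW road at every door (12Zᴳ-Top's four families, weakened by the guard), §2 on the (1.89)-DISCHARGED road at every door with
# `γ ≤ e⁻³` (12Zᴳ-b's per-run list at the TOP-LEVEL fully pinned layer `λᴾ`: `hsel`, the (1.100) pin, the run's window `hI`, print's first p.200 condition `hwin`, NODE O's (2.7) smallness,
# `hε10`, the (2.7) upper bound ALL theorems); §0 the one-token window arithmetic that hands a closer the sixteenth door letter `γ ≤ e⁻³`
# (Track A, DAG node N12 = [B15, Balaban1989LargeFieldI] CMP **122** (1989) 175–202; cluster K1 — K1⁸ `StabilityBRunRowsAtRecordR13SepCoPH` = stmt-QuantumFields-26907, helper;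
# seat `pub-ymgap-dag-n12-d` g17 (R134 s2 «knit at the record»), 2026-08-28; count-neutral, CONDITIONAL, NOT a discharge)

HONEST FRAMING.  Count-neutral kernel COMPOSITION BY NAME.  WHY THIS FILE (LOCATED-H12-W): K1⁸ BY NAME (dag-n24-c Part 34 `…N24K1R8ByNameOfOpenStubsChildrenSplitP2DMixedW`, p619673) reads
N12 as `∃ lamW, (∀ P, lamW.kSel P < P.K → B15Leaf (WOfRecord₁₃ F 2 θW lamW P)) ∧ hsel` at EVERY run below the torus — in NODE O's window or not — and consumes it only through the MIXED W-pin
(`if lamW.kSel P < P.K then WOfRecord₁₃ … else` g4's degenerate leaf-carrier; `hsel` discarded).  Every producer in the tree that DISCHARGES (1.89) (dag-n12-e's `claim189_sitOfHist₁₃_N0_of_inInterval`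
∘ 12I ∕ 12Pᵂ ∕ 12Zᴳ-b) reads the RUN's window `Step.InInterval θW.γ (kSel P + 1) (gOfRecord₁₃ F 2 θW P)` and NODE O's (2.7) smallness `SmallnessFor θW.γ …` (⟹ `θW.γ ≤ e⁻³`, 12Iᵂ §3); print
never claims [IV]'s basic step outside `]0, γ]` ([IV] (1.2) p.178, [B12] Thm 1 p.259).  So the honest N12 socket is WINDOW-GUARDED — the leaf owed on runs with
`Step.InInterval γ₁₂ P.K (gOfRecord₁₃ F 2 θW P)` for a `γ₁₂ > 0` of N12's choosing (the flow dag-n24-c's `hUV` row already quantifies: `gOfRecord₁₃ θ P = genSeq (betaOfRecord₁₃ θ) P.g0`), the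
world's mixed pin reading `if lamW.kSel P < P.K ∧ Step.InInterval γ₁₂ P.K (…) then … else …` (zero cost to N24: `Nodes (leavesP w P)` still at every run).  THIS FILE SUPPLIES THAT SOCKET.
§1 (RAW road, every door): 12Zᴳ-Top's guarded pair ∕ family (`…GenericDoorTopLevel`, kSel := K − 1, (1.100) pin `rfl`) weakened by the guard — `γ₁₂ := 1`, four raw per-run families (live-mass
at the top slot, Prop. 1 at `LF P`, (1.80) ∕ (1.89) at `D189 P`).  §2 ((1.89)-DISCHARGED road, every door WITH `hγe : γ ≤ e⁻³`): `γ₁₂ := γ` and the TOP-LEVEL fully pinned layer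
`λᴾ := (({λ with kSel := K − 1, D1100 := …}).pinRPrime₁₃ θW).pinD189ΛH ν A₁ M g σᶻ s Nm p₁` (dag-n12-e's `Λ`∕cube∕dist∕`Z″`∕`N₀`∕`Z_res`∕sides∕`χ(Ω^∼4)`∕`Ω″` pins; 12P ∕ 12Pᵂ) — 12Pᵂ §1
`…TermPinnedZresWindow.b15Leaf_WOfRecord₁₃_pinAllΛΩχZ_N0_liveRepin₁₃_of_massLive_of_hasResiduals_of_inInterval` at `Θ := theta13OfNumerics … (stage12NumericsOfThm1CCMW …) …` with: `hK` ⟸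
`Nat.sub_lt`; (1.100) pin ⟸ `rfl`; `hI` ⟸ THE GUARD (`θW.γ = γ` by `rfl`, levels by `omega`); `hwin` ⟸ 12Iᵂ §4 `hwin_of_inInterval` from the guard + the COUPLING-FREE letter `hC`; `S` ⟸ 12Iᵂ
`smallnessFor_half_two_one` at `max β′ 0` from `hγe` and the door's `β′γ² ≤ ¾`; `hε10` ⟸ 12Iᵂ `gamma_mul_p0Profile_le_tenth` (`A₀ᶜᶜ¹ ≤ 1∕16`, K0a); `hup` ⟸ the door's upper box at `max β′ 0`;
`0 < M₂ = 1`, `0 < M = L^j`, `r = 1`.  WHICH CHILD BLOCKS §2, per in-window run with `1 ≤ K` (every binder a family `∀ P, 1 ≤ P.K → Step.InInterval γ P.K (gOfRecord₁₃ F 2 θW P) → …`):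
positive mass of the LIVE pre-𝐑 terms at the top slot (NODE 00) · Proposition 1 (1.78) at `λ.LF P` (dag-n12-c ∕ w-lineage; object pin = this seat's 12Q⁸ line) · the levels `N₀(P) ≤ Nm P`,
`N₀(P) ≤ K` · the base situation's residual numbers `0 ≤ β ≤ ¼`, `2 ≤ L₀`, `L₀² ≤ L`, `0 ≤ O(1)B₃B₅`, `0 ≤ δ` · print's p.200 conditions as the coupling-free window letter `hC`
(`4(2 + (121∕120)²O(1)B₃B₅M⁵) ≤ (log γ⁻²)^{log L₀²∕log L}`) and `hMl` · `β ≥ 0` along the run's history `hβhist` (N12 READS the sign of β through the coupling step of the (1.89) pin — NODE O's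
sign box is the producer; K0's sign-free box is not) · `Λ ≠ ∅` · the four ℍ-leaves (1.91)ₕ ∕ (1.95) ∕ (1.91) ∕ (1.97) and (1.80) at `D P = λᴾ.D189 P`.  NOT displayed any more: Claim (1.89),
the (1.100) pin, `hsel`, `hI`, `hwin`, the (2.7) letters.  Door letters read by §2: `0 < γ ≤ ½`, `0 ≤ B₃`, `0 ≤ B₃′`, `0 < a₀`, `0 < a₁`, the upper box `hbox′` with `β′γ² ≤ ¾`, and
`γ ≤ e⁻³`.  §0 `windowLetters_of_absBetaBoxH_expNegThree` = dag-n24-c Part 19 §0 `windowLetters_of_absBetaBoxH` ∧ `γ ≤ e⁻³` (`γ := min · e⁻³`, boxes by `FlowStep.box_mono`) — the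
one-token change that gives a closer the sixteenth door letter.  Nothing of Bałaban's is asserted; every printed fact is a hypothesis; N12 is NOT discharged; no node is discharged; K0⁷ ∕ K1⁸
NOT closed; counts unmoved (discharged 5∕27 · Track A 5∕28).  ONE finite four-torus programme at fixed `ε = L^{-K}` — nothing continuum ∕ ℝ⁴ ∕ OS ∕ mass gap ∕ Clay.  No `sorry`, `def`,
`instance`, `notation`.

Sources: [Balaban1989LargeFieldI] (0.1)–(0.6) pp.175–176, (1.2) p.178, (1.10)–(1.11) p.179, (1.73) p.192, Prop. 1 (1.78) p.194, (1.80) p.195, (1.89) p.198, (1.91)–(1.97) pp.198–199,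
(1.99)–(1.102) pp.200–201; [Balaban1988Convergent] (2.1)–(2.9) pp.254–256, (2.13) p.257, (2.17)–(2.18) p.257, (3.16)–(3.25) pp.268–270; [Balaban1987RG1] Thm 1 p.259, (0.17)–(0.20) pp.255–256,
§1 p.264; [Balaban1985Variational] Thm 1 (8)–(9) p.279; [Balaban1989LargeFieldII] Thm 1 p.355 (bookkeeping: the unread door letters).
-/

noncomputable section

open MeasureTheory
open scoped Matrix.Norms.L2Operator

namespace Summit.QuantumFields.YangMills.BalabanUVNodes.N12AtTheta13OfThm1CCMWGenericDoorWindowGuard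

open Literature.MathematicalPhysics.QuantumFieldTheory.Balaban1983to89
open Literature.MathematicalPhysics.QuantumFieldTheory.Balaban1983to89.T4Continuum (T4Family)
open Literature.MathematicalPhysics.QuantumFieldTheory.Balaban1983to89.DagBinding
open Literature.MathematicalPhysics.QuantumFieldTheory.Balaban1983to89.Node00
open FlowStep (prefixOf BetaLowerH BetaUpperH)
open B14FlowStep (SmallnessFor)
open B15Claim189Assembly (Setting189 new189 chiPP dom half)
open B15 (Prop1Printed Ineq180)
open B15.BasicStep (Claim189)
open B15.PrelimIntegrations (Ineq191 Ineq195)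
open B15Chi124DetSets (E124)
open B15DeterminingSets (MSField)
open B14DomainGeom (Pt)
open B8Eq17ClassAkV1 (plaqsOf)
open GaugeGroup (dist1)
open GaugeField (plaqHol)
open B15Claim189PrintedConditions (omegaOfChain)
open B15Claim189PinsOfHistory (N0OfRecord₁₃)
open B15Claim189LambdaPin (enlD)
open B15RPrime1100OfRep (rPrimeDataOfSel)
open Summit.QuantumFields.YangMills.BalabanUVNodes.N24K1ConsequentOfStubsV19AndChildren (windowLetters_of_absBetaBoxH)
open Summit.QuantumFields.YangMills.BalabanUVNodes.N12AtTheta13OfThm1CCMWGenericDoorTopLevel (exists_residW_b15Leaf_below_theta13OfThm1CCMW_topLevel_of_massLive)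
open Summit.QuantumFields.YangMills.BalabanUVNodes.N12AtRecord13TermPinnedZresWindow (b15Leaf_WOfRecord₁₃_pinAllΛΩχZ_N0_liveRepin₁₃_of_massLive_of_hasResiduals_of_inInterval)
open Summit.QuantumFields.YangMills.BalabanUVNodes.N12AtTheta13OfThm1CCMWSmallWindow (gamma_mul_p0Profile_le_tenth smallnessFor_half_two_one hwin_of_inInterval)

variable {F : T4Family}

/-! ## §0 WINDOW ARITHMETIC: dag-n24-c Part 19 §0's shrunk window, shrunk once more below `e⁻³` (the sixteenth door letter, one token for a closer) -/

/-- **ABS BOX ⟹ WINDOWED BOX WITH LETTERS ON A (2.7)-SMALL WINDOW** (any `β : HBeta`): Part 19 §0 `windowLetters_of_absBetaBoxH`'s conclusion AND `γ ≤ e⁻³` — take its `γ₁` and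
`γ := min γ₁ e⁻³`; the two letters survive (`0 ≤ β′` from the non-empty box `]0, γ₁]^1`, `γ² ≤ γ₁²`), the boxes restrict by `FlowStep.box_mono`.  With it a closer that opens K0's 3ᴬ′ box can
carry `hγe : γ ≤ Real.exp (-3)` as a sixteenth door letter at no other cost (every child family is `∀` over doors). Elementary bookkeeping behind «γ sufficiently small» + NODE O's (2.7).
[cite: Balaban1987RG1, Thm 1 p.259, §1 p.264; Balaban1988Convergent, (2.7) p.255 (bookkeeping)] -/
theorem windowLetters_of_absBetaBoxH_expNegThree {β : FlowStep.HBeta} {γ₀ β' : ℝ} (hγ0 : 0 < γ₀) (hlow : BetaLowerH (-β') γ₀ β) (hup : BetaUpperH β' γ₀ β) :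
    ∃ γ : ℝ, 0 < γ ∧ γ ≤ 1 / 2 ∧ γ ≤ Real.exp (-3) ∧ -(-β') * γ ^ 2 ≤ 3 ∧ β' * γ ^ 2 ≤ 3 / 4 ∧ BetaLowerH (-β') γ β ∧ BetaUpperH β' γ β := by
  obtain ⟨γ₁, hγ₁, hγ₁h, hl, hu, hlo, hhi⟩ := windowLetters_of_absBetaBoxH hγ0 hlow hup
  have hv : (fun _ : Fin (0 + 1) => γ₁) ∈ FlowStep.Box γ₁ 0 := FlowStep.mem_box.mpr fun _ => ⟨hγ₁, le_rfl⟩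
  have hβ' : 0 ≤ β' := by
    have h1 := hlo 0 _ hv
    have h2 := hhi 0 _ hv
    linarith
  have hle : min γ₁ (Real.exp (-3)) ≤ γ₁ := min_le_left _ _
  have hpos : 0 < min γ₁ (Real.exp (-3)) := lt_min hγ₁ (Real.exp_pos _)
  have hsq : (min γ₁ (Real.exp (-3))) ^ 2 ≤ γ₁ ^ 2 := pow_le_pow_left₀ hpos.le hle 2
  refine ⟨min γ₁ (Real.exp (-3)), hpos, hle.trans hγ₁h, min_le_right _ _, ?_, ?_,
    fun k v hv => hlo k v (FlowStep.box_mono hle k hv), fun k v hv => hhi k v (FlowStep.box_mono hle k hv)⟩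
  · have : β' * (min γ₁ (Real.exp (-3))) ^ 2 ≤ β' * γ₁ ^ 2 := mul_le_mul_of_nonneg_left hsq hβ'
    linarith
  · have : β' * (min γ₁ (Real.exp (-3))) ^ 2 ≤ β' * γ₁ ^ 2 := mul_le_mul_of_nonneg_left hsq hβ'
    linarith

/-! ## §1 THE WINDOW-GUARDED FAMILY ON THE RAW ROAD, EVERY DOOR: 12Zᴳ-Top's four raw families, weakened by the guard (`γ₁₂ := 1`) -/

section RawRoad
variable {j : ℕ} {γ ε₀ ε₂₉ B₃ B₃' a₀ a₁ : ℝ} (lamW : ResidW F 2)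

/-- **THE WINDOW-GUARDED N12 SOCKET AT ONE WITNESS, RAW ROAD** — `∃ γ₁₂ > 0, ∃ lamW, ∀ P, lamW.kSel P < P.K → Step.InInterval γ₁₂ P.K (gOfRecord₁₃ F 2 θW P) → B15Leaf (WOfRecord₁₃ F 2 θW lamW P)`
with `γ₁₂ := 1` (the guard unused): 12Zᴳ-Top's pair from four raw per-run families (live-mass at the top slot, Prop. 1 at `λ.LF P`, (1.80) ∕ (1.89) at `λ.D189 P`).  Reads no door letter.
CONDITIONAL; nothing of Bałaban asserted; N12 NOT discharged. [cite: Balaban1989LargeFieldI, (0.1)–(0.6) pp.175–176, Prop. 1 (1.78) p.194, (1.80) p.195, (1.89) p.198, (1.99)–(1.102) pp.200–201; Balaban1987RG1, Thm 1 p.259 (bookkeeping)] -/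
theorem exists_gamma_residW_b15Leaf_window_theta13OfThm1CCMW_raw_of_massLive
    (h12massTop : ∀ P : B12.RunParams, 1 ≤ P.K → ∀ s, LiveSeq F 2 (theta13OfThm1CCMW F 2 j γ ε₀ ε₂₉ B₃ B₃' a₀ a₁).ν (theta13OfThm1CCMW F 2 j γ ε₀ ε₂₉ B₃ B₃' a₀ a₁).τ9 P (gOfRecord₁₃ F 2 (theta13OfThm1CCMW F 2 j γ ε₀ ε₂₉ B₃ B₃' a₀ a₁) P) (P.K - 1 + 1)
        (slotsTOfRecord F 2 (theta13OfThm1CCMW F 2 j γ ε₀ ε₂₉ B₃ B₃' a₀ a₁).ν (theta13OfThm1CCMW F 2 j γ ε₀ ε₂₉ B₃ B₃' a₀ a₁).τ9 (EOfRecord₁₃ F 2 (theta13OfThm1CCMW F 2 j γ ε₀ ε₂₉ B₃ B₃' a₀ a₁)) (wOfRecord₉ F 2 (theta13OfThm1CCMW F 2 j γ ε₀ ε₂₉ B₃ B₃' a₀ a₁).toStage9Params)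
          (theta13OfThm1CCMW F 2 j γ ε₀ ε₂₉ B₃ B₃' a₀ a₁).ppSel P (gOfRecord₁₃ F 2 (theta13OfThm1CCMW F 2 j γ ε₀ ε₂₉ B₃ B₃' a₀ a₁) P) (P.K - 1 + 1)) s →
      0 < ∫ V, rterm (reprTOfRecord₁₃ F 2 (theta13OfThm1CCMW F 2 j γ ε₀ ε₂₉ B₃ B₃' a₀ a₁) P (P.K - 1)) s V ∂(fieldMeasure (F.P P.K) (P.K - 1 + 1) (SU 2)))
    (h12P1 : ∀ P : B12.RunParams, 1 ≤ P.K → Prop1Printed (lamW.LF P))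
    (h12i180 : ∀ P : B12.RunParams, 1 ≤ P.K → ∀ U, new189 (lamW.D189 P) U → ∀ i, (lamW.D189 P).h ≤ i → i ≤ (lamW.D189 P).k →
      ∀ q ∈ plaqsOf (dom (lamW.D189 P) i),
        Ineq180 ((lamW.D189 P).dev0 U q) ((lamW.D189 P).ε (lamW.D189 P).k) (lamW.D189 P).η (lamW.D189 P).B₃ (lamW.D189 P).B₅ (lamW.D189 P).M (lamW.D189 P).δ
          ((lamW.D189 P).dist q) (lamW.D189 P).O1)
    (h12c189 : ∀ P : B12.RunParams, 1 ≤ P.K → Claim189 (new189 (lamW.D189 P)) (chiPP (lamW.D189 P))) :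
    ∃ γ₁₂ : ℝ, 0 < γ₁₂ ∧ ∃ lamW : ResidW F 2, ∀ P : B12.RunParams, lamW.kSel P < P.K → Step.InInterval γ₁₂ P.K (gOfRecord₁₃ F 2 (theta13OfThm1CCMW F 2 j γ ε₀ ε₂₉ B₃ B₃' a₀ a₁) P) →
        B15Leaf (WOfRecord₁₃ F 2 (theta13OfThm1CCMW F 2 j γ ε₀ ε₂₉ B₃ B₃' a₀ a₁) lamW P) := by
  obtain ⟨lamW', h, -⟩ := exists_residW_b15Leaf_below_theta13OfThm1CCMW_topLevel_of_massLive lamW h12massTop h12P1 h12i180 h12c189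
  exact ⟨1, one_pos, lamW', fun P hk _ => h P hk⟩

end RawRoad

section RawRoadFamily
variable (lamW : ∀ (j : ℕ) (γ ε₀ ε₂₉ B₃ B₃' a₀ a₁ : ℝ), ResidW F 2)

/-- **THE WINDOW-GUARDED N12 FAMILY OVER dag-n24-c's FIFTEEN DOOR LETTERS, RAW ROAD** (the proposed slot edition's TYPE; ASK-2): from 12Zᴳ-Top's four raw families over the witness
letters only; `γ₁₂ := 1`; none of the door letters is read. CONDITIONAL; N12 NOT discharged; K0⁷ ∕ K1⁸ NOT closed. [cite: Balaban1989LargeFieldI, (0.1)–(0.6) pp.175–176, Prop. 1 (1.78) p.194, (1.80) p.195, (1.89) p.198, (1.99)–(1.102) pp.200–201; Balaban1985Variational, Thm 1 (8)–(9) p.279; Balaban1987RG1, Thm 1 p.259, §1 p.264 (bookkeeping: the unread door letters)] -/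
theorem h12W_theta13OfThm1CCMW_raw_of_massLive
    (h12massTopF : ∀ (j : ℕ) (γ ε₀ ε₂₉ B₃ B₃' a₀ a₁ : ℝ), ∀ P : B12.RunParams, 1 ≤ P.K → ∀ s, LiveSeq F 2 (theta13OfThm1CCMW F 2 j γ ε₀ ε₂₉ B₃ B₃' a₀ a₁).ν (theta13OfThm1CCMW F 2 j γ ε₀ ε₂₉ B₃ B₃' a₀ a₁).τ9 P (gOfRecord₁₃ F 2 (theta13OfThm1CCMW F 2 j γ ε₀ ε₂₉ B₃ B₃' a₀ a₁) P) (P.K - 1 + 1)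
        (slotsTOfRecord F 2 (theta13OfThm1CCMW F 2 j γ ε₀ ε₂₉ B₃ B₃' a₀ a₁).ν (theta13OfThm1CCMW F 2 j γ ε₀ ε₂₉ B₃ B₃' a₀ a₁).τ9 (EOfRecord₁₃ F 2 (theta13OfThm1CCMW F 2 j γ ε₀ ε₂₉ B₃ B₃' a₀ a₁)) (wOfRecord₉ F 2 (theta13OfThm1CCMW F 2 j γ ε₀ ε₂₉ B₃ B₃' a₀ a₁).toStage9Params)
          (theta13OfThm1CCMW F 2 j γ ε₀ ε₂₉ B₃ B₃' a₀ a₁).ppSel P (gOfRecord₁₃ F 2 (theta13OfThm1CCMW F 2 j γ ε₀ ε₂₉ B₃ B₃' a₀ a₁) P) (P.K - 1 + 1)) s →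
      0 < ∫ V, rterm (reprTOfRecord₁₃ F 2 (theta13OfThm1CCMW F 2 j γ ε₀ ε₂₉ B₃ B₃' a₀ a₁) P (P.K - 1)) s V ∂(fieldMeasure (F.P P.K) (P.K - 1 + 1) (SU 2)))
    (h12P1F : ∀ (j : ℕ) (γ ε₀ ε₂₉ B₃ B₃' a₀ a₁ : ℝ), ∀ P : B12.RunParams, 1 ≤ P.K → Prop1Printed ((lamW j γ ε₀ ε₂₉ B₃ B₃' a₀ a₁).LF P))
    (h12i180F : ∀ (j : ℕ) (γ ε₀ ε₂₉ B₃ B₃' a₀ a₁ : ℝ), ∀ P : B12.RunParams, 1 ≤ P.K → ∀ U, new189 ((lamW j γ ε₀ ε₂₉ B₃ B₃' a₀ a₁).D189 P) U → ∀ i, ((lamW j γ ε₀ ε₂₉ B₃ B₃' a₀ a₁).D189 P).h ≤ i → i ≤ ((lamW j γ ε₀ ε₂₉ B₃ B₃' a₀ a₁).D189 P).k →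
      ∀ q ∈ plaqsOf (dom ((lamW j γ ε₀ ε₂₉ B₃ B₃' a₀ a₁).D189 P) i),
        Ineq180 (((lamW j γ ε₀ ε₂₉ B₃ B₃' a₀ a₁).D189 P).dev0 U q) (((lamW j γ ε₀ ε₂₉ B₃ B₃' a₀ a₁).D189 P).ε ((lamW j γ ε₀ ε₂₉ B₃ B₃' a₀ a₁).D189 P).k) ((lamW j γ ε₀ ε₂₉ B₃ B₃' a₀ a₁).D189 P).η ((lamW j γ ε₀ ε₂₉ B₃ B₃' a₀ a₁).D189 P).B₃ ((lamW j γ ε₀ ε₂₉ B₃ B₃' a₀ a₁).D189 P).B₅ ((lamW j γ ε₀ ε₂₉ B₃ B₃' a₀ a₁).D189 P).M ((lamW j γ ε₀ ε₂₉ B₃ B₃' a₀ a₁).D189 P).δ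
          (((lamW j γ ε₀ ε₂₉ B₃ B₃' a₀ a₁).D189 P).dist q) ((lamW j γ ε₀ ε₂₉ B₃ B₃' a₀ a₁).D189 P).O1)
    (h12c189F : ∀ (j : ℕ) (γ ε₀ ε₂₉ B₃ B₃' a₀ a₁ : ℝ), ∀ P : B12.RunParams, 1 ≤ P.K → Claim189 (new189 ((lamW j γ ε₀ ε₂₉ B₃ B₃' a₀ a₁).D189 P)) (chiPP ((lamW j γ ε₀ ε₂₉ B₃ B₃' a₀ a₁).D189 P))) :
    ∀ {j c : ℕ} {γ ε₀ ε₂₉ B₃ B₃' a₀ a₁ : ℝ} (hγ₀ : 0 < γ) (hγh : γ ≤ 1 / 2) (hε : 0 < ε₀) (hε' : 0 < ε₂₉) (hB : 0 ≤ B₃) (hB' : 0 ≤ B₃') (ha₀ : 0 < a₀) (ha₁ : 0 < a₁) (h15 : VariationalThm1RegSepCoP7M F 2 B₃ a₀ a₁) (hc : c ≤ F.L ^ j) (h9 : Gauge9RegSepTopStepR F 2 (fun ν K Ω => suppDomOfRecord F ν K Ω) (F.L ^ j) c B₃ B₃' a₀ a₁) {bl β' : ℝ} (hbox : BetaLowerH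 bl γ (betaOfRecord₁₃ F 2 (theta13OfThm1CCMW F 2 j γ ε₀ ε₂₉ B₃ B₃' a₀ a₁))) (hbox' : BetaUpperH β' γ (betaOfRecord₁₃ F 2 (theta13OfThm1CCMW F 2 j γ ε₀ ε₂₉ B₃ B₃' a₀ a₁))) (hl : -bl * γ ^ 2 ≤ 3) (hβ' : β' * γ ^ 2 ≤ 3 / 4),
      ∃ γ₁₂ : ℝ, 0 < γ₁₂ ∧ ∃ lamW : ResidW F 2, ∀ P : B12.RunParams, lamW.kSel P < P.K → Step.InInterval γ₁₂ P.K (gOfRecord₁₃ F 2 (theta13OfThm1CCMW F 2 j γ ε₀ ε₂₉ B₃ B₃' a₀ a₁) P) →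
        B15Leaf (WOfRecord₁₃ F 2 (theta13OfThm1CCMW F 2 j γ ε₀ ε₂₉ B₃ B₃' a₀ a₁) lamW P) := by
  intro j _ γ ε₀ ε₂₉ B₃ B₃' a₀ a₁ _ _ _ _ _ _ _ _ _ _ _ _ _ _ _ _ _
  exact exists_gamma_residW_b15Leaf_window_theta13OfThm1CCMW_raw_of_massLive (lamW j γ ε₀ ε₂₉ B₃ B₃' a₀ a₁)
    (h12massTopF j γ ε₀ ε₂₉ B₃ B₃' a₀ a₁) (h12P1F j γ ε₀ ε₂₉ B₃ B₃' a₀ a₁) (h12i180F j γ ε₀ ε₂₉ B₃ B₃' a₀ a₁) (h12c189F j γ ε₀ ε₂₉ B₃ B₃' a₀ a₁)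

end RawRoadFamily

/-! ## §2 THE (1.89)-DISCHARGED ROAD AT A DOOR WITH `γ ≤ e⁻³`: 12Zᴳ-b's per-run list at the TOP-LEVEL fully pinned layer `λᴾ`, `γ₁₂ := γ` -/

section WindowRoad
variable {j : ℕ} {γ ε₀ ε₂₉ B₃ B₃' a₀ a₁ : ℝ} (lam : ResidW F 2) (σ : ∀ P : B12.RunParams, Sit189 F 2 P.K)
  (s : ∀ P : B12.RunParams, SeqOfRecord F (theta13OfThm1CCMW F 2 j γ ε₀ ε₂₉ B₃ B₃' a₀ a₁).ν (theta13OfThm1CCMW F 2 j γ ε₀ ε₂₉ B₃ B₃' a₀ a₁).τ9.M (gOfRecord₁₃ F 2 (theta13OfThm1CCMW F 2 j γ ε₀ ε₂₉ B₃ B₃' a₀ a₁) P) P.K (P.K - 1 + 1)) (Nm : B12.RunParams → ℕ) (p₁ : ℕ)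

/-- **★★ THE WINDOW-GUARDED N12 SOCKET AT ONE DOOR `θW = θ₁₅ᶜᶜᴹᵂ(j;γ;ε₀,ε₂₉;B₃,B₃',a₀,a₁)` WITH `γ ≤ e⁻³`, (1.89) DISCHARGED** — `∃ γ₁₂ > 0, ∃ lamW, ∀ P, lamW.kSel P < P.K →
Step.InInterval γ₁₂ P.K (gOfRecord₁₃ F 2 θW P) → B15Leaf (WOfRecord₁₃ F 2 θW lamW P)` with `γ₁₂ := γ` and `lamW := λᴾ` the TOP-LEVEL (`kSel := K − 1`, (1.100)-pinned) fully pinned layer of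
record over `λ.LF` (its (1.89) setting `D P := λᴾ.D189 P` displayed by the equation `hD`): 12Pᵂ §1 at `Θ := theta13OfNumerics … (stage12NumericsOfThm1CCMW …) …` with `hK`, the pin, `hI`
(⟸ the guard), `hwin` (⟸ 12Iᵂ §4 `hwin_of_inInterval` + `hC`), `S`, `hε10`, `hup`, `0 < M₂`, `0 < M`, `r = 1` ALL DISCHARGED.  Displayed per in-window run with `1 ≤ K`: live-mass at the top
slot, Prop. 1 at `λ.LF P`, the levels, the base situation's residual numbers, `hC`, `hMl`, `hβhist`, `Λ ≠ ∅`, the four ℍ-leaves and (1.80) at `D P`.  Door letters read: `0 < γ ≤ ½`, the signs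
`0 ≤ B₃`, `0 ≤ B₃'`, `0 < a₀`, `0 < a₁`, the upper box `hbox'` with `β'γ² ≤ ¾`, `γ ≤ e⁻³`.  CONDITIONAL on the displayed rows; nothing of Bałaban asserted; N12 NOT discharged.
[cite: Balaban1989LargeFieldI, (0.1)–(0.6) pp.175–176, (1.2) p.178, (1.10)–(1.11) p.179, (1.73) p.192, Prop. 1 (1.78) p.194, (1.80) p.195, (1.89) p.198, (1.91)–(1.97) pp.198–199, (1.99)–(1.102) pp.200–201; Balaban1988Convergent, (2.1)–(2.9) pp.254–256, (2.17)–(2.18) p.257, (3.16)–(3.25) pp.268–270; Balaban1987RG1, Thm 1 p.259, (0.20) p.256] -/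
theorem exists_gamma_residW_b15Leaf_window_theta13OfThm1CCMW_topLevel_pinnedΛΩχZ_of_massLive
    (hγ₀ : 0 < γ) (hγh : γ ≤ 1 / 2) (hB : 0 ≤ B₃) (hB' : 0 ≤ B₃') (ha₀ : 0 < a₀) (ha₁ : 0 < a₁)
    {β' : ℝ} (hbox' : BetaUpperH β' γ (betaOfRecord₁₃ F 2 (theta13OfThm1CCMW F 2 j γ ε₀ ε₂₉ B₃ B₃' a₀ a₁))) (hβ' : β' * γ ^ 2 ≤ 3 / 4) (hγe : γ ≤ Real.exp (-3))
    (D : ∀ P : B12.RunParams, Setting189 (F.P P.K) (SU 2) (MSField (F.P P.K) (SU 2) × ((j : ℕ) → VecField (F.P P.K) j (EuclideanSpace ℝ (Fin (2 ^ 2 - 1))))) (Pt (F.P P.K).d))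
    (hD : ∀ P : B12.RunParams, D P = ((({ lam with kSel := fun P : B12.RunParams => P.K - 1, D1100 := fun P : B12.RunParams => rPrimeDataOfSel (reprTOfRecord₁₃ F 2 (theta13OfThm1CCMW F 2 j γ ε₀ ε₂₉ B₃ B₃' a₀ a₁) P (P.K - 1)) ((theta13OfThm1CCMW F 2 j γ ε₀ ε₂₉ B₃ B₃' a₀ a₁).ppSel P (gOfRecord₁₃ F 2 (theta13OfThm1CCMW F 2 j γ ε₀ ε₂₉ B₃ B₃' a₀ a₁) P) (P.K - 1 + 1)) (fibOfSeq F (theta13OfThm1CCMW F 2 j γ ε₀ ε₂₉ B₃ B₃' a₀ a₁).ν (theta13OfThm1CCMW F 2 j γ ε₀ ε₂₉ B₃ B₃' a₀ a₁).τ9 P (gOfRecord₁₃ F 2 (theta13OfThm1CCMW F 2 j γ ε₀ ε₂₉ B₃ B₃' a₀ a₁) P) (P.K - 1 + 1)) } : ResidW F 2).pinRPrime₁₃ (theta13OfThm1CCMW F 2 j γ ε₀ ε₂₉ B₃ B₃' a₀ a₁)).pinD189ΛH (theta13OfThm1CCMW F 2 j γ ε₀ ε₂₉ B₃ B₃' a₀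 a₁).ν (theta13OfThm1CCMW F 2 j γ ε₀ ε₂₉ B₃ B₃' a₀ a₁).A₁ (theta13OfThm1CCMW F 2 j γ ε₀ ε₂₉ B₃ B₃' a₀ a₁).τ9.M (gOfRecord₁₃ F 2 (theta13OfThm1CCMW F 2 j γ ε₀ ε₂₉ B₃ B₃' a₀ a₁)) (fun P => (((((σ P).pinZres (theta13OfThm1CCMW F 2 j γ ε₀ ε₂₉ B₃ B₃' a₀ a₁).ν (theta13OfThm1CCMW F 2 j γ ε₀ ε₂₉ B₃ B₃' a₀ a₁).τ9.M (gOfRecord₁₃ F 2 (theta13OfThm1CCMW F 2 j γ ε₀ ε₂₉ B₃ B₃' a₀ a₁) P) (s P) (N0OfRecord₁₃ (theta13OfThm1CCMW F 2 j γ ε₀ ε₂₉ B₃ B₃' a₀ a₁) P (P.K - 1 + 1))).pinSides (theta13OfThm1CCMW F 2 j γ ε₀ ε₂₉ B₃ B₃' a₀ a₁).ν (gOfRecord₁₃ F 2 (theta13OfThm1CCMW F 2 j γ ε₀ ε₂₉ B₃ B₃' a₀ a₁) P) (P.K - 1 + 1 - Nm P) (P.K - 1 + 1)).pinXΩ4 (s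 P) (enlD F (theta13OfThm1CCMW F 2 j γ ε₀ ε₂₉ B₃ B₃' a₀ a₁).ν (theta13OfThm1CCMW F 2 j γ ε₀ ε₂₉ B₃ B₃' a₀ a₁).τ9.M P (gOfRecord₁₃ F 2 (theta13OfThm1CCMW F 2 j γ ε₀ ε₂₉ B₃ B₃' a₀ a₁) P))).pinOmegaPP (s P) (Nm P) (enlD F (theta13OfThm1CCMW F 2 j γ ε₀ ε₂₉ B₃ B₃' a₀ a₁).ν (theta13OfThm1CCMW F 2 j γ ε₀ ε₂₉ B₃ B₃' a₀ a₁).τ9.M P (gOfRecord₁₃ F 2 (theta13OfThm1CCMW F 2 j γ ε₀ ε₂₉ B₃ B₃' a₀ a₁) P)))) s Nm p₁).D189 P)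
    (hmassLive : ∀ P : B12.RunParams, 1 ≤ P.K → Step.InInterval γ P.K (gOfRecord₁₃ F 2 (theta13OfThm1CCMW F 2 j γ ε₀ ε₂₉ B₃ B₃' a₀ a₁) P) → ∀ a, LiveSeq F 2 (theta13OfThm1CCMW F 2 j γ ε₀ ε₂₉ B₃ B₃' a₀ a₁).ν (theta13OfThm1CCMW F 2 j γ ε₀ ε₂₉ B₃ B₃' a₀ a₁).τ9 P (gOfRecord₁₃ F 2 (theta13OfThm1CCMW F 2 j γ ε₀ ε₂₉ B₃ B₃' a₀ a₁) P) (P.K - 1 + 1)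
        (slotsTOfRecord F 2 (theta13OfThm1CCMW F 2 j γ ε₀ ε₂₉ B₃ B₃' a₀ a₁).ν (theta13OfThm1CCMW F 2 j γ ε₀ ε₂₉ B₃ B₃' a₀ a₁).τ9 (EOfRecord₁₃ F 2 (theta13OfThm1CCMW F 2 j γ ε₀ ε₂₉ B₃ B₃' a₀ a₁)) (wOfRecord₉ F 2 (theta13OfThm1CCMW F 2 j γ ε₀ ε₂₉ B₃ B₃' a₀ a₁).toStage9Params)
          (theta13OfThm1CCMW F 2 j γ ε₀ ε₂₉ B₃ B₃' a₀ a₁).ppSel P (gOfRecord₁₃ F 2 (theta13OfThm1CCMW F 2 j γ ε₀ ε₂₉ B₃ B₃' a₀ a₁) P) (P.K - 1 + 1)) a →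
      0 < ∫ V, rterm (reprTOfRecord₁₃ F 2 (theta13OfThm1CCMW F 2 j γ ε₀ ε₂₉ B₃ B₃' a₀ a₁) P (P.K - 1)) a V ∂(fieldMeasure (F.P P.K) (P.K - 1 + 1) (SU 2)))
    (hP1 : ∀ P : B12.RunParams, 1 ≤ P.K → Step.InInterval γ P.K (gOfRecord₁₃ F 2 (theta13OfThm1CCMW F 2 j γ ε₀ ε₂₉ B₃ B₃' a₀ a₁) P) → Prop1Printed (lam.LF P))
    (hNN : ∀ P : B12.RunParams, 1 ≤ P.K → Step.InInterval γ P.K (gOfRecord₁₃ F 2 (theta13OfThm1CCMW F 2 j γ ε₀ ε₂₉ B₃ B₃' a₀ a₁) P) → N0OfRecord₁₃ (theta13OfThm1CCMW F 2 j γ ε₀ ε₂₉ B₃ B₃' a₀ a₁) P (P.K - 1 + 1) ≤ Nm P)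
    (hNk : ∀ P : B12.RunParams, 1 ≤ P.K → Step.InInterval γ P.K (gOfRecord₁₃ F 2 (theta13OfThm1CCMW F 2 j γ ε₀ ε₂₉ B₃ B₃' a₀ a₁) P) → N0OfRecord₁₃ (theta13OfThm1CCMW F 2 j γ ε₀ ε₂₉ B₃ B₃' a₀ a₁) P (P.K - 1 + 1) ≤ P.K - 1 + 1)
    (hβ0 : ∀ P : B12.RunParams, 1 ≤ P.K → Step.InInterval γ P.K (gOfRecord₁₃ F 2 (theta13OfThm1CCMW F 2 j γ ε₀ ε₂₉ B₃ B₃' a₀ a₁) P) → 0 ≤ (σ P).β)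
    (hβ : ∀ P : B12.RunParams, 1 ≤ P.K → Step.InInterval γ P.K (gOfRecord₁₃ F 2 (theta13OfThm1CCMW F 2 j γ ε₀ ε₂₉ B₃ B₃' a₀ a₁) P) → (σ P).β ≤ 1 / 4)
    (hL₀ : ∀ P : B12.RunParams, 1 ≤ P.K → Step.InInterval γ P.K (gOfRecord₁₃ F 2 (theta13OfThm1CCMW F 2 j γ ε₀ ε₂₉ B₃ B₃' a₀ a₁) P) → 2 ≤ (σ P).L₀)
    (hL₀L : ∀ P : B12.RunParams, 1 ≤ P.K → Step.InInterval γ P.K (gOfRecord₁₃ F 2 (theta13OfThm1CCMW F 2 j γ ε₀ ε₂₉ B₃ B₃' a₀ a₁) P) → (σ P).L₀ ^ 2 ≤ ((F.P P.K).L : ℝ))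
    (hOB : ∀ P : B12.RunParams, 1 ≤ P.K → Step.InInterval γ P.K (gOfRecord₁₃ F 2 (theta13OfThm1CCMW F 2 j γ ε₀ ε₂₉ B₃ B₃' a₀ a₁) P) → 0 ≤ (σ P).O1 * (σ P).B₃ * (σ P).B₅)
    (hδ : ∀ P : B12.RunParams, 1 ≤ P.K → Step.InInterval γ P.K (gOfRecord₁₃ F 2 (theta13OfThm1CCMW F 2 j γ ε₀ ε₂₉ B₃ B₃' a₀ a₁) P) → 0 ≤ (σ P).δ)
    (hC : ∀ P : B12.RunParams, 1 ≤ P.K → Step.InInterval γ P.K (gOfRecord₁₃ F 2 (theta13OfThm1CCMW F 2 j γ ε₀ ε₂₉ B₃ B₃' a₀ a₁) P) →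
      4 * (2 + (121 / 120) ^ 2 * ((σ P).O1 * (σ P).B₃ * (σ P).B₅ * ((theta13OfThm1CCMW F 2 j γ ε₀ ε₂₉ B₃ B₃' a₀ a₁).τ9.M : ℝ) ^ 5)) ≤ (Real.log (γ ^ 2)⁻¹) ^ (Real.log ((σ P).L₀ ^ 2) / Real.log ((F.P P.K).L : ℝ)))
    (hβhist : ∀ P : B12.RunParams, 1 ≤ P.K → Step.InInterval γ P.K (gOfRecord₁₃ F 2 (theta13OfThm1CCMW F 2 j γ ε₀ ε₂₉ B₃ B₃' a₀ a₁) P) → ∀ i, i < P.K - 1 + 1 → 0 ≤ betaOfRecord₁₃ F 2 (theta13OfThm1CCMW F 2 j γ ε₀ ε₂₉ B₃ B₃' a₀ a₁) i (prefixOf (gOfRecord₁₃ F 2 (theta13OfThm1CCMW F 2 j γ ε₀ ε₂₉ B₃ B₃' a₀ a₁) P) i))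
    (hMl : ∀ P : B12.RunParams, 1 ≤ P.K → Step.InInterval γ P.K (gOfRecord₁₃ F 2 (theta13OfThm1CCMW F 2 j γ ε₀ ε₂₉ B₃ B₃' a₀ a₁) P) → (121 / 120) ^ 2 * ((σ P).O1 * (σ P).B₃ * (σ P).B₅ * ((theta13OfThm1CCMW F 2 j γ ε₀ ε₂₉ B₃ B₃' a₀ a₁).τ9.M : ℝ) ^ 5) * Real.exp (-(4 * (σ P).δ * ((theta13OfThm1CCMW F 2 j γ ε₀ ε₂₉ B₃ B₃' a₀ a₁).τ9.M : ℝ))) ≤ 1 / 12)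
    (hΛ : ∀ P : B12.RunParams, 1 ≤ P.K → Step.InInterval γ P.K (gOfRecord₁₃ F 2 (theta13OfThm1CCMW F 2 j γ ε₀ ε₂₉ B₃ B₃' a₀ a₁) P) → (((enlD F (theta13OfThm1CCMW F 2 j γ ε₀ ε₂₉ B₃ B₃' a₀ a₁).ν (theta13OfThm1CCMW F 2 j γ ε₀ ε₂₉ B₃ B₃' a₀ a₁).τ9.M P (gOfRecord₁₃ F 2 (theta13OfThm1CCMW F 2 j γ ε₀ ε₂₉ B₃ B₃' a₀ a₁) P)) 4 (P.K - 1 + 1 + 1 - (N0OfRecord₁₃ (theta13OfThm1CCMW F 2 j γ ε₀ ε₂₉ B₃ B₃' a₀ a₁) P (P.K - 1 + 1)))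
        (omegaOfChain (s P) (P.K - 1 + 1 + 1 - (N0OfRecord₁₃ (theta13OfThm1CCMW F 2 j γ ε₀ ε₂₉ B₃ B₃' a₀ a₁) P (P.K - 1 + 1)))))ᶜ ∩ (σ P).Z).Nonempty)
    (L91h : ∀ P : B12.RunParams, 1 ≤ P.K → Step.InInterval γ P.K (gOfRecord₁₃ F 2 (theta13OfThm1CCMW F 2 j γ ε₀ ε₂₉ B₃ B₃' a₀ a₁) P) → ∀ U, new189 (D P) U → ∀ p ∈ plaqsOf (half (D P)),
      Ineq191 (dist1 (plaqHol ((D P).Upp U) p)) ((D P).devV'' U p) (D P).α (((D P).L ^ (D P).h)⁻¹) ((D P).ε (D P).h) (E124 (D P).ε (D P).L (D P).η (D P).k (D P).h))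
    (L95 : ∀ P : B12.RunParams, 1 ≤ P.K → Step.InInterval γ P.K (gOfRecord₁₃ F 2 (theta13OfThm1CCMW F 2 j γ ε₀ ε₂₉ B₃ B₃' a₀ a₁) P) → ∀ U, new189 (D P) U → ∀ p ∈ plaqsOf (half (D P)),
      Ineq195 ((D P).devV'' U p) (dist1 (plaqHol ((D P).Uhalf U ((D P).boxOf p)) p)) (D P).α (((D P).L ^ (D P).h)⁻¹) ((D P).ε (D P).h) (E124 (D P).ε (D P).L (D P).η (D P).k (D P).h))
    (L91 : ∀ P : B12.RunParams, 1 ≤ P.K → Step.InInterval γ P.K (gOfRecord₁₃ F 2 (theta13OfThm1CCMW F 2 j γ ε₀ ε₂₉ B₃ B₃' a₀ a₁) P) → ∀ U, new189 (D P) U → ∀ i, (D P).h ≤ i → i ≤ (D P).k → ∀ p ∈ plaqsOf (dom (D P) i),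
      Ineq191 (dist1 (plaqHol ((D P).Upp U) p)) ((D P).dev97 U p) (D P).α (((D P).L ^ i)⁻¹) ((D P).ε i) (E124 (D P).ε (D P).L (D P).η (D P).k i))
    (L97 : ∀ P : B12.RunParams, 1 ≤ P.K → Step.InInterval γ P.K (gOfRecord₁₃ F 2 (theta13OfThm1CCMW F 2 j γ ε₀ ε₂₉ B₃ B₃' a₀ a₁) P) → ∀ U, new189 (D P) U → ∀ i, (D P).h ≤ i → i ≤ (D P).k → ∀ p ∈ plaqsOf (dom (D P) i),
      Ineq191 ((D P).dev97 U p) ((D P).dev0 U p) (D P).α (((D P).L ^ i)⁻¹) ((D P).ε i) (E124 (D P).ε (D P).L (D P).η (D P).k i))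
    (L80 : ∀ P : B12.RunParams, 1 ≤ P.K → Step.InInterval γ P.K (gOfRecord₁₃ F 2 (theta13OfThm1CCMW F 2 j γ ε₀ ε₂₉ B₃ B₃' a₀ a₁) P) → ∀ U, new189 (D P) U → ∀ i, (D P).h ≤ i → i ≤ (D P).k → ∀ p ∈ plaqsOf (dom (D P) i),
      Ineq180 ((D P).dev0 U p) ((D P).ε (D P).k) (D P).η (D P).B₃ (D P).B₅ (D P).M (D P).δ ((D P).dist p) (D P).O1) :
    ∃ γ₁₂ : ℝ, 0 < γ₁₂ ∧ ∃ lamW : ResidW F 2, ∀ P : B12.RunParams, lamW.kSel P < P.K → Step.InInterval γ₁₂ P.K (gOfRecord₁₃ F 2 (theta13OfThm1CCMW F 2 j γ ε₀ ε₂₉ B₃ B₃' a₀ a₁) P) →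
        B15Leaf (WOfRecord₁₃ F 2 (theta13OfThm1CCMW F 2 j γ ε₀ ε₂₉ B₃ B₃' a₀ a₁) lamW P) := by
  -- the (2.7) letters at `max β' 0` (12Zᴳ-b): the door's upper box transfers by `le_max_left`; `γ²·max β' 0 ≤ 1` from `β'γ² ≤ ¾`
  have hbox'' : BetaUpperH (max β' 0) γ (betaOfRecord₁₃ F 2 (theta13OfThm1CCMW F 2 j γ ε₀ ε₂₉ B₃ B₃' a₀ a₁)) :=
    fun k v hv => (hbox' k v hv).trans (le_max_left _ _)
  have hγβ' : γ ^ 2 * max β' 0 ≤ 1 := by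
    rcases le_total β' 0 with hβ'0 | hβ'0
    · rw [max_eq_right hβ'0, mul_zero]; exact zero_le_one
    · rw [max_eq_left hβ'0]; nlinarith [hβ', sq_nonneg γ]
  -- K0a: `A₀ᶜᶜ¹ ∈ [0, 1∕16]` for the flow-profile letter
  have hA : 0 ≤ A0OfThm1CC1 F.L B₃ B₃' a₀ a₁ := A0OfThm1CC1_nonneg hB hB' ha₀.le ha₁.le
  have hA' : A0OfThm1CC1 F.L B₃ B₃' a₀ a₁ ≤ 1 / 16 := (A0OfThm1CC1_le hB hB' ha₀.le ha₁.le).trans (A0OfThm1C_le_sixteenth hB)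
  refine ⟨γ, hγ₀, ((({ lam with kSel := fun P : B12.RunParams => P.K - 1, D1100 := fun P : B12.RunParams => rPrimeDataOfSel (reprTOfRecord₁₃ F 2 (theta13OfThm1CCMW F 2 j γ ε₀ ε₂₉ B₃ B₃' a₀ a₁) P (P.K - 1)) ((theta13OfThm1CCMW F 2 j γ ε₀ ε₂₉ B₃ B₃' a₀ a₁).ppSel P (gOfRecord₁₃ F 2 (theta13OfThm1CCMW F 2 j γ ε₀ ε₂₉ B₃ B₃' a₀ a₁) P) (P.K - 1 + 1)) (fibOfSeq F (theta13OfThm1CCMW F 2 j γ ε₀ ε₂₉ B₃ B₃' a₀ a₁).ν (theta13OfThm1CCMW F 2 j γ ε₀ ε₂₉ B₃ B₃' a₀ a₁).τ9 P (gOfRecord₁₃ F 2 (theta13OfThm1CCMW F 2 j γ ε₀ ε₂₉ B₃ B₃' a₀ a₁) P) (P.K - 1 + 1)) } : ResidW F 2).pinRPrime₁₃ (theta13OfThm1CCMW F 2 j γ ε₀ ε₂₉ B₃ B₃' a₀ a₁)).pinD189ΛH (theta13OfThm1CCMW F 2 j γ ε₀ ε₂₉ B₃ B₃' a₀ a₁).ν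 (theta13OfThm1CCMW F 2 j γ ε₀ ε₂₉ B₃ B₃' a₀ a₁).A₁ (theta13OfThm1CCMW F 2 j γ ε₀ ε₂₉ B₃ B₃' a₀ a₁).τ9.M (gOfRecord₁₃ F 2 (theta13OfThm1CCMW F 2 j γ ε₀ ε₂₉ B₃ B₃' a₀ a₁)) (fun P => (((((σ P).pinZres (theta13OfThm1CCMW F 2 j γ ε₀ ε₂₉ B₃ B₃' a₀ a₁).ν (theta13OfThm1CCMW F 2 j γ ε₀ ε₂₉ B₃ B₃' a₀ a₁).τ9.M (gOfRecord₁₃ F 2 (theta13OfThm1CCMW F 2 j γ ε₀ ε₂₉ B₃ B₃' a₀ a₁) P) (s P) (N0OfRecord₁₃ (theta13OfThm1CCMW F 2 j γ ε₀ ε₂₉ B₃ B₃' a₀ a₁) P (P.K - 1 + 1))).pinSides (theta13OfThm1CCMW F 2 j γ ε₀ ε₂₉ B₃ B₃' a₀ a₁).ν (gOfRecord₁₃ F 2 (theta13OfThm1CCMW F 2 j γ ε₀ ε₂₉ B₃ B₃' a₀ a₁) P) (P.K - 1 + 1 - Nm P) (P.K - 1 + 1)).pinXΩ4 (s P) (enlD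 F (theta13OfThm1CCMW F 2 j γ ε₀ ε₂₉ B₃ B₃' a₀ a₁).ν (theta13OfThm1CCMW F 2 j γ ε₀ ε₂₉ B₃ B₃' a₀ a₁).τ9.M P (gOfRecord₁₃ F 2 (theta13OfThm1CCMW F 2 j γ ε₀ ε₂₉ B₃ B₃' a₀ a₁) P))).pinOmegaPP (s P) (Nm P) (enlD F (theta13OfThm1CCMW F 2 j γ ε₀ ε₂₉ B₃ B₃' a₀ a₁).ν (theta13OfThm1CCMW F 2 j γ ε₀ ε₂₉ B₃ B₃' a₀ a₁).τ9.M P (gOfRecord₁₃ F 2 (theta13OfThm1CCMW F 2 j γ ε₀ ε₂₉ B₃ B₃' a₀ a₁) P)))) s Nm p₁), fun P hk hIK => ?_⟩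
  have hK : 1 ≤ P.K := Nat.one_le_of_lt hk
  -- the run's window up to the top slot IS the guard (`θW.γ = γ` by `rfl`)
  have hI : Step.InInterval (theta13OfThm1CCMW F 2 j γ ε₀ ε₂₉ B₃ B₃' a₀ a₁).γ (P.K - 1 + 1) (gOfRecord₁₃ F 2 (theta13OfThm1CCMW F 2 j γ ε₀ ε₂₉ B₃ B₃' a₀ a₁) P) := fun k hk' => hIK k (by omega)
  -- print's first p.200 condition from the guard + the coupling-free letter `hC` (12Iᵂ §4)
  have hwin : 4 * (2 + (121 / 120) ^ 2 * ((σ P).O1 * (σ P).B₃ * (σ P).B₅ * ((theta13OfThm1CCMW F 2 j γ ε₀ ε₂₉ B₃ B₃' a₀ a₁).τ9.M : ℝ) ^ 5))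
      ≤ ((Real.log ((gOfRecord₁₃ F 2 (theta13OfThm1CCMW F 2 j γ ε₀ ε₂₉ B₃ B₃' a₀ a₁) P) (P.K - 1 + 1) ^ 2)⁻¹) ^ (theta13OfThm1CCMW F 2 j γ ε₀ ε₂₉ B₃ B₃' a₀ a₁).ν.r) ^ (Real.log ((σ P).L₀ ^ 2) / Real.log ((F.P P.K).L : ℝ)) :=
    hwin_of_inInterval hIK (k := P.K - 1 + 1) (by omega) hγe (r := (theta13OfThm1CCMW F 2 j γ ε₀ ε₂₉ B₃ B₃' a₀ a₁).ν.r) le_rfl (by linarith [hL₀ P hK hIK]) (Nat.one_le_cast.mpr (F.P P.K).L_pos) (hC P hK hIK)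
  exact b15Leaf_WOfRecord₁₃_pinAllΛΩχZ_N0_liveRepin₁₃_of_massLive_of_hasResiduals_of_inInterval
    (theta13OfNumerics F 2 (stage12NumericsOfThm1CCMW F.L j γ ε₀ B₃ B₃' a₀ a₁) ε₂₉ (zeta316OfRecord F 2 (stage12NumericsOfThm1CCMW F.L j γ ε₀ B₃ B₃' a₀ a₁).ν (stage12NumericsOfThm1CCMW F.L j γ ε₀ B₃ B₃' a₀ a₁).τ9.M (stage12NumericsOfThm1CCMW F.L j γ ε₀ B₃ B₃' a₀ a₁).A₁) (RzOfRecord F 2) (ZtOfRecord F 2))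
    ({ lam with kSel := fun P : B12.RunParams => P.K - 1, D1100 := fun P : B12.RunParams => rPrimeDataOfSel (reprTOfRecord₁₃ F 2 (theta13OfThm1CCMW F 2 j γ ε₀ ε₂₉ B₃ B₃' a₀ a₁) P (P.K - 1)) ((theta13OfThm1CCMW F 2 j γ ε₀ ε₂₉ B₃ B₃' a₀ a₁).ppSel P (gOfRecord₁₃ F 2 (theta13OfThm1CCMW F 2 j γ ε₀ ε₂₉ B₃ B₃' a₀ a₁) P) (P.K - 1 + 1)) (fibOfSeq F (theta13OfThm1CCMW F 2 j γ ε₀ ε₂₉ B₃ B₃' a₀ a₁).ν (theta13OfThm1CCMW F 2 j γ ε₀ ε₂₉ B₃ B₃' a₀ a₁).τ9 P (gOfRecord₁₃ F 2 (theta13OfThm1CCMW F 2 j γ ε₀ ε₂₉ B₃ B₃' a₀ a₁) P) (P.K - 1 + 1)) } : ResidW F 2) σ s Nm p₁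
    (hasResidualsOfRecord_theta13OfNumerics F 2 (stage12NumericsOfThm1CCMW F.L j γ ε₀ B₃ B₃' a₀ a₁) ε₂₉) (hM₂ := Nat.one_pos) (hM := pow_pos (Nat.zero_lt_of_lt F.hL.2) j) (hr := le_rfl)
    (hA₀ := hA) (S := smallnessFor_half_two_one hγ₀ hγe (le_max_right β' 0) hγβ') (hβ₀ := by norm_num) (hε10 := gamma_mul_p0Profile_le_tenth hγ₀ hγh hA hA')
    (hup := hbox'') (hI := hI) (hwin := hwin)
    (hK := Nat.sub_lt hK Nat.one_pos) (hD := hD P) (hmassLive := hmassLive P hK hIK) (hP1 := hP1 P hK hIK) (hNN := hNN P hK hIK) (hNk := hNk P hK hIK)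
    (hβ0 := hβ0 P hK hIK) (hβ := hβ P hK hIK) (hL₀ := hL₀ P hK hIK) (hL₀L := hL₀L P hK hIK) (hB := hOB P hK hIK) (hδ := hδ P hK hIK) (hβhist := hβhist P hK hIK)
    (hMl := hMl P hK hIK) (hΛ := hΛ P hK hIK) (L91h := L91h P hK hIK) (L95 := L95 P hK hIK) (L91 := L91 P hK hIK) (L97 := L97 P hK hIK) (L80 := L80 P hK hIK)

end WindowRoad

section WindowRoadFamily
variable (lam : ∀ (j : ℕ) (γ ε₀ ε₂₉ B₃ B₃' a₀ a₁ : ℝ), ResidW F 2) (σ : ∀ (j : ℕ) (γ ε₀ ε₂₉ B₃ B₃' a₀ a₁ : ℝ), ∀ P : B12.RunParams, Sit189 F 2 P.K)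
  (s : ∀ (j : ℕ) (γ ε₀ ε₂₉ B₃ B₃' a₀ a₁ : ℝ), ∀ P : B12.RunParams, SeqOfRecord F (theta13OfThm1CCMW F 2 j γ ε₀ ε₂₉ B₃ B₃' a₀ a₁).ν (theta13OfThm1CCMW F 2 j γ ε₀ ε₂₉ B₃ B₃' a₀ a₁).τ9.M (gOfRecord₁₃ F 2 (theta13OfThm1CCMW F 2 j γ ε₀ ε₂₉ B₃ B₃' a₀ a₁) P) P.K (P.K - 1 + 1)) (Nm : ∀ (j : ℕ) (γ ε₀ ε₂₉ B₃ B₃' a₀ a₁ : ℝ), B12.RunParams → ℕ)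
  (p₁ : ∀ (j : ℕ) (γ ε₀ ε₂₉ B₃ B₃' a₀ a₁ : ℝ), ℕ)

/-- **★★ THE WINDOW-GUARDED N12 FAMILY OVER THE SIXTEEN DOOR LETTERS (dag-n24-c's fifteen + `hγe : γ ≤ e⁻³`), (1.89) DISCHARGED** — the slot edition's TYPE under a door shrunk below
`e⁻³` (§0), from §2's per-run families over the witness letters: live-mass at the top slot · Prop. 1 at `LF P` · levels · residual numbers · `hC` · `hβhist` · `hMl` · `Λ ≠ ∅` · four ℍ-leaves
+ (1.80) at `D … P = λᴾ.D189 P`; door letters read: `hγ₀ hγh hγe hB hB' ha₀ ha₁ hbox' hβ'` (the others unread).  CONDITIONAL; nothing of Bałaban asserted; N12 NOT discharged; K0⁷ ∕ K1⁸ NOT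
closed. [cite: Balaban1989LargeFieldI, (0.1)–(0.6) pp.175–176, (1.2) p.178, Prop. 1 (1.78) p.194, (1.80) p.195, (1.89) p.198, (1.91)–(1.97) pp.198–199, (1.99)–(1.102) pp.200–201; Balaban1988Convergent, (2.1)–(2.9) pp.254–256, (2.17)–(2.18) p.257, (3.16)–(3.25) pp.268–270; Balaban1987RG1, Thm 1 p.259, §1 p.264; Balaban1985Variational, Thm 1 (8)–(9) p.279 (bookkeeping: the unread door letters)] -/
theorem h12W_theta13OfThm1CCMW_pinnedΛΩχZ_of_massLive_of_window
    (D : ∀ (j : ℕ) (γ ε₀ ε₂₉ B₃ B₃' a₀ a₁ : ℝ), ∀ P : B12.RunParams, Setting189 (F.P P.K) (SU 2) (MSField (F.P P.K) (SU 2) × ((j : ℕ) → VecField (F.P P.K) j (EuclideanSpace ℝ (Fin (2 ^ 2 - 1))))) (Pt (F.P P.K).d))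
    (hDF : ∀ (j : ℕ) (γ ε₀ ε₂₉ B₃ B₃' a₀ a₁ : ℝ), ∀ P : B12.RunParams, D j γ ε₀ ε₂₉ B₃ B₃' a₀ a₁ P = ((({ lam j γ ε₀ ε₂₉ B₃ B₃' a₀ a₁ with kSel := fun P : B12.RunParams => P.K - 1, D1100 := fun P : B12.RunParams => rPrimeDataOfSel (reprTOfRecord₁₃ F 2 (theta13OfThm1CCMW F 2 j γ ε₀ ε₂₉ B₃ B₃' a₀ a₁) P (P.K - 1)) ((theta13OfThm1CCMW F 2 j γ ε₀ ε₂₉ B₃ B₃' a₀ a₁).ppSel P (gOfRecord₁₃ F 2 (theta13OfThm1CCMW F 2 j γ ε₀ ε₂₉ B₃ B₃' a₀ a₁) P) (P.K - 1 + 1)) (fibOfSeq F (theta13OfThm1CCMW F 2 j γ ε₀ ε₂₉ B₃ B₃' a₀ a₁).ν (theta13OfThm1CCMW F 2 j γ ε₀ ε₂₉ B₃ B₃' a₀ a₁).τ9 P (gOfRecord₁₃ F 2 (theta13OfThm1CCMW F 2 j γ ε₀ ε₂₉ B₃ B₃' a₀ a₁) P) (P.K - 1 + 1)) } : ResidW F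 2).pinRPrime₁₃ (theta13OfThm1CCMW F 2 j γ ε₀ ε₂₉ B₃ B₃' a₀ a₁)).pinD189ΛH (theta13OfThm1CCMW F 2 j γ ε₀ ε₂₉ B₃ B₃' a₀ a₁).ν (theta13OfThm1CCMW F 2 j γ ε₀ ε₂₉ B₃ B₃' a₀ a₁).A₁ (theta13OfThm1CCMW F 2 j γ ε₀ ε₂₉ B₃ B₃' a₀ a₁).τ9.M (gOfRecord₁₃ F 2 (theta13OfThm1CCMW F 2 j γ ε₀ ε₂₉ B₃ B₃' a₀ a₁)) (fun P => (((((σ j γ ε₀ ε₂₉ B₃ B₃' a₀ a₁ P).pinZres (theta13OfThm1CCMW F 2 j γ ε₀ ε₂₉ B₃ B₃' a₀ a₁).ν (theta13OfThm1CCMW F 2 j γ ε₀ ε₂₉ B₃ B₃' a₀ a₁).τ9.M (gOfRecord₁₃ F 2 (theta13OfThm1CCMW F 2 j γ ε₀ ε₂₉ B₃ B₃' a₀ a₁) P) (s j γ ε₀ ε₂₉ B₃ B₃' a₀ a₁ P) (N0OfRecord₁₃ (theta13OfThm1CCMW F 2 j γ ε₀ ε₂₉ B₃ B₃' a₀ a₁)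 P (P.K - 1 + 1))).pinSides (theta13OfThm1CCMW F 2 j γ ε₀ ε₂₉ B₃ B₃' a₀ a₁).ν (gOfRecord₁₃ F 2 (theta13OfThm1CCMW F 2 j γ ε₀ ε₂₉ B₃ B₃' a₀ a₁) P) (P.K - 1 + 1 - Nm j γ ε₀ ε₂₉ B₃ B₃' a₀ a₁ P) (P.K - 1 + 1)).pinXΩ4 (s j γ ε₀ ε₂₉ B₃ B₃' a₀ a₁ P) (enlD F (theta13OfThm1CCMW F 2 j γ ε₀ ε₂₉ B₃ B₃' a₀ a₁).ν (theta13OfThm1CCMW F 2 j γ ε₀ ε₂₉ B₃ B₃' a₀ a₁).τ9.M P (gOfRecord₁₃ F 2 (theta13OfThm1CCMW F 2 j γ ε₀ ε₂₉ B₃ B₃' a₀ a₁) P))).pinOmegaPP (s j γ ε₀ ε₂₉ B₃ B₃' a₀ a₁ P) (Nm j γ ε₀ ε₂₉ B₃ B₃' a₀ a₁ P) (enlD F (theta13OfThm1CCMW F 2 j γ ε₀ ε₂₉ B₃ B₃' a₀ a₁).ν (theta13OfThm1CCMW F 2 j γ ε₀ ε₂₉ B₃ B₃' a₀ a₁).τ9.M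 P (gOfRecord₁₃ F 2 (theta13OfThm1CCMW F 2 j γ ε₀ ε₂₉ B₃ B₃' a₀ a₁) P)))) (s j γ ε₀ ε₂₉ B₃ B₃' a₀ a₁) (Nm j γ ε₀ ε₂₉ B₃ B₃' a₀ a₁) (p₁ j γ ε₀ ε₂₉ B₃ B₃' a₀ a₁)).D189 P)
    (hmassLiveF : ∀ (j : ℕ) (γ ε₀ ε₂₉ B₃ B₃' a₀ a₁ : ℝ), ∀ P : B12.RunParams, 1 ≤ P.K → Step.InInterval γ P.K (gOfRecord₁₃ F 2 (theta13OfThm1CCMW F 2 j γ ε₀ ε₂₉ B₃ B₃' a₀ a₁) P) → ∀ a, LiveSeq F 2 (theta13OfThm1CCMW F 2 j γ ε₀ ε₂₉ B₃ B₃' a₀ a₁).ν (theta13OfThm1CCMW F 2 j γ ε₀ ε₂₉ B₃ B₃' a₀ a₁).τ9 P (gOfRecord₁₃ F 2 (theta13OfThm1CCMW F 2 j γ ε₀ ε₂₉ B₃ B₃' a₀ a₁) P) (P.K - 1 + 1)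
        (slotsTOfRecord F 2 (theta13OfThm1CCMW F 2 j γ ε₀ ε₂₉ B₃ B₃' a₀ a₁).ν (theta13OfThm1CCMW F 2 j γ ε₀ ε₂₉ B₃ B₃' a₀ a₁).τ9 (EOfRecord₁₃ F 2 (theta13OfThm1CCMW F 2 j γ ε₀ ε₂₉ B₃ B₃' a₀ a₁)) (wOfRecord₉ F 2 (theta13OfThm1CCMW F 2 j γ ε₀ ε₂₉ B₃ B₃' a₀ a₁).toStage9Params)
          (theta13OfThm1CCMW F 2 j γ ε₀ ε₂₉ B₃ B₃' a₀ a₁).ppSel P (gOfRecord₁₃ F 2 (theta13OfThm1CCMW F 2 j γ ε₀ ε₂₉ B₃ B₃' a₀ a₁) P) (P.K - 1 + 1)) a →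
      0 < ∫ V, rterm (reprTOfRecord₁₃ F 2 (theta13OfThm1CCMW F 2 j γ ε₀ ε₂₉ B₃ B₃' a₀ a₁) P (P.K - 1)) a V ∂(fieldMeasure (F.P P.K) (P.K - 1 + 1) (SU 2)))
    (hP1F : ∀ (j : ℕ) (γ ε₀ ε₂₉ B₃ B₃' a₀ a₁ : ℝ), ∀ P : B12.RunParams, 1 ≤ P.K → Step.InInterval γ P.K (gOfRecord₁₃ F 2 (theta13OfThm1CCMW F 2 j γ ε₀ ε₂₉ B₃ B₃' a₀ a₁) P) → Prop1Printed ((lam j γ ε₀ ε₂₉ B₃ B₃' a₀ a₁).LF P))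
    (hNNF : ∀ (j : ℕ) (γ ε₀ ε₂₉ B₃ B₃' a₀ a₁ : ℝ), ∀ P : B12.RunParams, 1 ≤ P.K → Step.InInterval γ P.K (gOfRecord₁₃ F 2 (theta13OfThm1CCMW F 2 j γ ε₀ ε₂₉ B₃ B₃' a₀ a₁) P) → N0OfRecord₁₃ (theta13OfThm1CCMW F 2 j γ ε₀ ε₂₉ B₃ B₃' a₀ a₁) P (P.K - 1 + 1) ≤ Nm j γ ε₀ ε₂₉ B₃ B₃' a₀ a₁ P)
    (hNkF : ∀ (j : ℕ) (γ ε₀ ε₂₉ B₃ B₃' a₀ a₁ : ℝ), ∀ P : B12.RunParams, 1 ≤ P.K → Step.InInterval γ P.K (gOfRecord₁₃ F 2 (theta13OfThm1CCMW F 2 j γ ε₀ ε₂₉ B₃ B₃' a₀ a₁) P) → N0OfRecord₁₃ (theta13OfThm1CCMW F 2 j γ ε₀ ε₂₉ B₃ B₃' a₀ a₁) P (P.K - 1 + 1) ≤ P.K - 1 + 1)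
    (hβ0F : ∀ (j : ℕ) (γ ε₀ ε₂₉ B₃ B₃' a₀ a₁ : ℝ), ∀ P : B12.RunParams, 1 ≤ P.K → Step.InInterval γ P.K (gOfRecord₁₃ F 2 (theta13OfThm1CCMW F 2 j γ ε₀ ε₂₉ B₃ B₃' a₀ a₁) P) → 0 ≤ (σ j γ ε₀ ε₂₉ B₃ B₃' a₀ a₁ P).β)
    (hβF : ∀ (j : ℕ) (γ ε₀ ε₂₉ B₃ B₃' a₀ a₁ : ℝ), ∀ P : B12.RunParams, 1 ≤ P.K → Step.InInterval γ P.K (gOfRecord₁₃ F 2 (theta13OfThm1CCMW F 2 j γ ε₀ ε₂₉ B₃ B₃' a₀ a₁) P) → (σ j γ ε₀ ε₂₉ B₃ B₃' a₀ a₁ P).β ≤ 1 / 4)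
    (hL₀F : ∀ (j : ℕ) (γ ε₀ ε₂₉ B₃ B₃' a₀ a₁ : ℝ), ∀ P : B12.RunParams, 1 ≤ P.K → Step.InInterval γ P.K (gOfRecord₁₃ F 2 (theta13OfThm1CCMW F 2 j γ ε₀ ε₂₉ B₃ B₃' a₀ a₁) P) → 2 ≤ (σ j γ ε₀ ε₂₉ B₃ B₃' a₀ a₁ P).L₀)
    (hL₀LF : ∀ (j : ℕ) (γ ε₀ ε₂₉ B₃ B₃' a₀ a₁ : ℝ), ∀ P : B12.RunParams, 1 ≤ P.K → Step.InInterval γ P.K (gOfRecord₁₃ F 2 (theta13OfThm1CCMW F 2 j γ ε₀ ε₂₉ B₃ B₃' a₀ a₁) P) → (σ j γ ε₀ ε₂₉ B₃ B₃' a₀ a₁ P).L₀ ^ 2 ≤ ((F.P P.K).L : ℝ))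
    (hOBF : ∀ (j : ℕ) (γ ε₀ ε₂₉ B₃ B₃' a₀ a₁ : ℝ), ∀ P : B12.RunParams, 1 ≤ P.K → Step.InInterval γ P.K (gOfRecord₁₃ F 2 (theta13OfThm1CCMW F 2 j γ ε₀ ε₂₉ B₃ B₃' a₀ a₁) P) → 0 ≤ (σ j γ ε₀ ε₂₉ B₃ B₃' a₀ a₁ P).O1 * (σ j γ ε₀ ε₂₉ B₃ B₃' a₀ a₁ P).B₃ * (σ j γ ε₀ ε₂₉ B₃ B₃' a₀ a₁ P).B₅)
    (hδF : ∀ (j : ℕ) (γ ε₀ ε₂₉ B₃ B₃' a₀ a₁ : ℝ), ∀ P : B12.RunParams, 1 ≤ P.K → Step.InInterval γ P.K (gOfRecord₁₃ F 2 (theta13OfThm1CCMW F 2 j γ ε₀ ε₂₉ B₃ B₃' a₀ a₁) P) → 0 ≤ (σ j γ ε₀ ε₂₉ B₃ B₃' a₀ a₁ P).δ)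
    (hCF : ∀ (j : ℕ) (γ ε₀ ε₂₉ B₃ B₃' a₀ a₁ : ℝ), ∀ P : B12.RunParams, 1 ≤ P.K → Step.InInterval γ P.K (gOfRecord₁₃ F 2 (theta13OfThm1CCMW F 2 j γ ε₀ ε₂₉ B₃ B₃' a₀ a₁) P) →
      4 * (2 + (121 / 120) ^ 2 * ((σ j γ ε₀ ε₂₉ B₃ B₃' a₀ a₁ P).O1 * (σ j γ ε₀ ε₂₉ B₃ B₃' a₀ a₁ P).B₃ * (σ j γ ε₀ ε₂₉ B₃ B₃' a₀ a₁ P).B₅ * ((theta13OfThm1CCMW F 2 j γ ε₀ ε₂₉ B₃ B₃' a₀ a₁).τ9.M : ℝ) ^ 5)) ≤ (Real.log (γ ^ 2)⁻¹) ^ (Real.log ((σ j γ ε₀ ε₂₉ B₃ B₃' a₀ a₁ P).L₀ ^ 2) / Real.log ((F.P P.K).L : ℝ)))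
    (hβhistF : ∀ (j : ℕ) (γ ε₀ ε₂₉ B₃ B₃' a₀ a₁ : ℝ), ∀ P : B12.RunParams, 1 ≤ P.K → Step.InInterval γ P.K (gOfRecord₁₃ F 2 (theta13OfThm1CCMW F 2 j γ ε₀ ε₂₉ B₃ B₃' a₀ a₁) P) → ∀ i, i < P.K - 1 + 1 → 0 ≤ betaOfRecord₁₃ F 2 (theta13OfThm1CCMW F 2 j γ ε₀ ε₂₉ B₃ B₃' a₀ a₁) i (prefixOf (gOfRecord₁₃ F 2 (theta13OfThm1CCMW F 2 j γ ε₀ ε₂₉ B₃ B₃' a₀ a₁) P) i))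
    (hMlF : ∀ (j : ℕ) (γ ε₀ ε₂₉ B₃ B₃' a₀ a₁ : ℝ), ∀ P : B12.RunParams, 1 ≤ P.K → Step.InInterval γ P.K (gOfRecord₁₃ F 2 (theta13OfThm1CCMW F 2 j γ ε₀ ε₂₉ B₃ B₃' a₀ a₁) P) → (121 / 120) ^ 2 * ((σ j γ ε₀ ε₂₉ B₃ B₃' a₀ a₁ P).O1 * (σ j γ ε₀ ε₂₉ B₃ B₃' a₀ a₁ P).B₃ * (σ j γ ε₀ ε₂₉ B₃ B₃' a₀ a₁ P).B₅ * ((theta13OfThm1CCMW F 2 j γ ε₀ ε₂₉ B₃ B₃' a₀ a₁).τ9.M : ℝ) ^ 5) * Real.exp (-(4 * (σ j γ ε₀ ε₂₉ B₃ B₃' a₀ a₁ P).δ * ((theta13OfThm1CCMW F 2 j γ ε₀ ε₂₉ B₃ B₃' a₀ a₁).τ9.M : ℝ))) ≤ 1 / 12)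
    (hΛF : ∀ (j : ℕ) (γ ε₀ ε₂₉ B₃ B₃' a₀ a₁ : ℝ), ∀ P : B12.RunParams, 1 ≤ P.K → Step.InInterval γ P.K (gOfRecord₁₃ F 2 (theta13OfThm1CCMW F 2 j γ ε₀ ε₂₉ B₃ B₃' a₀ a₁) P) → (((enlD F (theta13OfThm1CCMW F 2 j γ ε₀ ε₂₉ B₃ B₃' a₀ a₁).ν (theta13OfThm1CCMW F 2 j γ ε₀ ε₂₉ B₃ B₃' a₀ a₁).τ9.M P (gOfRecord₁₃ F 2 (theta13OfThm1CCMW F 2 j γ ε₀ ε₂₉ B₃ B₃' a₀ a₁) P)) 4 (P.K - 1 + 1 + 1 - (N0OfRecord₁₃ (theta13OfThm1CCMW F 2 j γ ε₀ ε₂₉ B₃ B₃' a₀ a₁) P (P.K - 1 + 1)))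
        (omegaOfChain (s j γ ε₀ ε₂₉ B₃ B₃' a₀ a₁ P) (P.K - 1 + 1 + 1 - (N0OfRecord₁₃ (theta13OfThm1CCMW F 2 j γ ε₀ ε₂₉ B₃ B₃' a₀ a₁) P (P.K - 1 + 1)))))ᶜ ∩ (σ j γ ε₀ ε₂₉ B₃ B₃' a₀ a₁ P).Z).Nonempty)
    (L91hF : ∀ (j : ℕ) (γ ε₀ ε₂₉ B₃ B₃' a₀ a₁ : ℝ), ∀ P : B12.RunParams, 1 ≤ P.K → Step.InInterval γ P.K (gOfRecord₁₃ F 2 (theta13OfThm1CCMW F 2 j γ ε₀ ε₂₉ B₃ B₃' a₀ a₁) P) → ∀ U, new189 (D j γ ε₀ ε₂₉ B₃ B₃' a₀ a₁ P) U → ∀ p ∈ plaqsOf (half (D j γ ε₀ ε₂₉ B₃ B₃' a₀ a₁ P)),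
      Ineq191 (dist1 (plaqHol ((D j γ ε₀ ε₂₉ B₃ B₃' a₀ a₁ P).Upp U) p)) ((D j γ ε₀ ε₂₉ B₃ B₃' a₀ a₁ P).devV'' U p) (D j γ ε₀ ε₂₉ B₃ B₃' a₀ a₁ P).α (((D j γ ε₀ ε₂₉ B₃ B₃' a₀ a₁ P).L ^ (D j γ ε₀ ε₂₉ B₃ B₃' a₀ a₁ P).h)⁻¹) ((D j γ ε₀ ε₂₉ B₃ B₃' a₀ a₁ P).ε (D j γ ε₀ ε₂₉ B₃ B₃' a₀ a₁ P).h) (E124 (D j γ ε₀ ε₂₉ B₃ B₃' a₀ a₁ P).ε (D j γ ε₀ ε₂₉ B₃ B₃' a₀ a₁ P).L (D j γ ε₀ ε₂₉ B₃ B₃' a₀ a₁ P).η (D j γ ε₀ ε₂₉ B₃ B₃' a₀ a₁ P).k (D j γ ε₀ ε₂₉ B₃ B₃' a₀ a₁ P).h))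
    (L95F : ∀ (j : ℕ) (γ ε₀ ε₂₉ B₃ B₃' a₀ a₁ : ℝ), ∀ P : B12.RunParams, 1 ≤ P.K → Step.InInterval γ P.K (gOfRecord₁₃ F 2 (theta13OfThm1CCMW F 2 j γ ε₀ ε₂₉ B₃ B₃' a₀ a₁) P) → ∀ U, new189 (D j γ ε₀ ε₂₉ B₃ B₃' a₀ a₁ P) U → ∀ p ∈ plaqsOf (half (D j γ ε₀ ε₂₉ B₃ B₃' a₀ a₁ P)),
      Ineq195 ((D j γ ε₀ ε₂₉ B₃ B₃' a₀ a₁ P).devV'' U p) (dist1 (plaqHol ((D j γ ε₀ ε₂₉ B₃ B₃' a₀ a₁ P).Uhalf U ((D j γ ε₀ ε₂₉ B₃ B₃' a₀ a₁ P).boxOf p)) p)) (D j γ ε₀ ε₂₉ B₃ B₃' a₀ a₁ P).α (((D j γ ε₀ ε₂₉ B₃ B₃' a₀ a₁ P).L ^ (D j γ ε₀ ε₂₉ B₃ B₃' a₀ a₁ P).h)⁻¹) ((D j γ ε₀ ε₂₉ B₃ B₃' a₀ a₁ P).ε (D j γ ε₀ ε₂₉ B₃ B₃' a₀ a₁ P).h)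 (E124 (D j γ ε₀ ε₂₉ B₃ B₃' a₀ a₁ P).ε (D j γ ε₀ ε₂₉ B₃ B₃' a₀ a₁ P).L (D j γ ε₀ ε₂₉ B₃ B₃' a₀ a₁ P).η (D j γ ε₀ ε₂₉ B₃ B₃' a₀ a₁ P).k (D j γ ε₀ ε₂₉ B₃ B₃' a₀ a₁ P).h))
    (L91F : ∀ (j : ℕ) (γ ε₀ ε₂₉ B₃ B₃' a₀ a₁ : ℝ), ∀ P : B12.RunParams, 1 ≤ P.K → Step.InInterval γ P.K (gOfRecord₁₃ F 2 (theta13OfThm1CCMW F 2 j γ ε₀ ε₂₉ B₃ B₃' a₀ a₁) P) → ∀ U, new189 (D j γ ε₀ ε₂₉ B₃ B₃' a₀ a₁ P) U → ∀ i, (D j γ ε₀ ε₂₉ B₃ B₃' a₀ a₁ P).h ≤ i → i ≤ (D j γ ε₀ ε₂₉ B₃ B₃' a₀ a₁ P).k → ∀ p ∈ plaqsOf (dom (D j γ ε₀ ε₂₉ B₃ B₃' a₀ a₁ P) i),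
      Ineq191 (dist1 (plaqHol ((D j γ ε₀ ε₂₉ B₃ B₃' a₀ a₁ P).Upp U) p)) ((D j γ ε₀ ε₂₉ B₃ B₃' a₀ a₁ P).dev97 U p) (D j γ ε₀ ε₂₉ B₃ B₃' a₀ a₁ P).α (((D j γ ε₀ ε₂₉ B₃ B₃' a₀ a₁ P).L ^ i)⁻¹) ((D j γ ε₀ ε₂₉ B₃ B₃' a₀ a₁ P).ε i) (E124 (D j γ ε₀ ε₂₉ B₃ B₃' a₀ a₁ P).ε (D j γ ε₀ ε₂₉ B₃ B₃' a₀ a₁ P).L (D j γ ε₀ ε₂₉ B₃ B₃' a₀ a₁ P).η (D j γ ε₀ ε₂₉ B₃ B₃' a₀ a₁ P).k i))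
    (L97F : ∀ (j : ℕ) (γ ε₀ ε₂₉ B₃ B₃' a₀ a₁ : ℝ), ∀ P : B12.RunParams, 1 ≤ P.K → Step.InInterval γ P.K (gOfRecord₁₃ F 2 (theta13OfThm1CCMW F 2 j γ ε₀ ε₂₉ B₃ B₃' a₀ a₁) P) → ∀ U, new189 (D j γ ε₀ ε₂₉ B₃ B₃' a₀ a₁ P) U → ∀ i, (D j γ ε₀ ε₂₉ B₃ B₃' a₀ a₁ P).h ≤ i → i ≤ (D j γ ε₀ ε₂₉ B₃ B₃' a₀ a₁ P).k → ∀ p ∈ plaqsOf (dom (D j γ ε₀ ε₂₉ B₃ B₃' a₀ a₁ P) i),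
      Ineq191 ((D j γ ε₀ ε₂₉ B₃ B₃' a₀ a₁ P).dev97 U p) ((D j γ ε₀ ε₂₉ B₃ B₃' a₀ a₁ P).dev0 U p) (D j γ ε₀ ε₂₉ B₃ B₃' a₀ a₁ P).α (((D j γ ε₀ ε₂₉ B₃ B₃' a₀ a₁ P).L ^ i)⁻¹) ((D j γ ε₀ ε₂₉ B₃ B₃' a₀ a₁ P).ε i) (E124 (D j γ ε₀ ε₂₉ B₃ B₃' a₀ a₁ P).ε (D j γ ε₀ ε₂₉ B₃ B₃' a₀ a₁ P).L (D j γ ε₀ ε₂₉ B₃ B₃' a₀ a₁ P).η (D j γ ε₀ ε₂₉ B₃ B₃' a₀ a₁ P).k i))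
    (L80F : ∀ (j : ℕ) (γ ε₀ ε₂₉ B₃ B₃' a₀ a₁ : ℝ), ∀ P : B12.RunParams, 1 ≤ P.K → Step.InInterval γ P.K (gOfRecord₁₃ F 2 (theta13OfThm1CCMW F 2 j γ ε₀ ε₂₉ B₃ B₃' a₀ a₁) P) → ∀ U, new189 (D j γ ε₀ ε₂₉ B₃ B₃' a₀ a₁ P) U → ∀ i, (D j γ ε₀ ε₂₉ B₃ B₃' a₀ a₁ P).h ≤ i → i ≤ (D j γ ε₀ ε₂₉ B₃ B₃' a₀ a₁ P).k → ∀ p ∈ plaqsOf (dom (D j γ ε₀ ε₂₉ B₃ B₃' a₀ a₁ P) i),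
      Ineq180 ((D j γ ε₀ ε₂₉ B₃ B₃' a₀ a₁ P).dev0 U p) ((D j γ ε₀ ε₂₉ B₃ B₃' a₀ a₁ P).ε (D j γ ε₀ ε₂₉ B₃ B₃' a₀ a₁ P).k) (D j γ ε₀ ε₂₉ B₃ B₃' a₀ a₁ P).η (D j γ ε₀ ε₂₉ B₃ B₃' a₀ a₁ P).B₃ (D j γ ε₀ ε₂₉ B₃ B₃' a₀ a₁ P).B₅ (D j γ ε₀ ε₂₉ B₃ B₃' a₀ a₁ P).M (D j γ ε₀ ε₂₉ B₃ B₃' a₀ a₁ P).δ ((D j γ ε₀ ε₂₉ B₃ B₃' a₀ a₁ P).dist p) (D j γ ε₀ ε₂₉ B₃ B₃' a₀ a₁ P).O1) :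
    ∀ {j c : ℕ} {γ ε₀ ε₂₉ B₃ B₃' a₀ a₁ : ℝ} (hγ₀ : 0 < γ) (hγh : γ ≤ 1 / 2) (hγe : γ ≤ Real.exp (-3)) (hε : 0 < ε₀) (hε' : 0 < ε₂₉) (hB : 0 ≤ B₃) (hB' : 0 ≤ B₃') (ha₀ : 0 < a₀) (ha₁ : 0 < a₁) (h15 : VariationalThm1RegSepCoP7M F 2 B₃ a₀ a₁) (hc : c ≤ F.L ^ j) (h9 : Gauge9RegSepTopStepR F 2 (fun ν K Ω => suppDomOfRecord F ν K Ω) (F.L ^ j) c B₃ B₃' a₀ a₁) {bl β' : ℝ} (hbox : BetaLowerH bl γ (betaOfRecord₁₃ F 2 (theta13OfThm1CCMW F 2 j γ ε₀ ε₂₉ B₃ B₃' a₀ a₁))) (hbox' : BetaUpperH β' γ (betaOfRecord₁₃ F 2 (theta13OfThm1CCMW F 2 j γ ε₀ ε₂₉ B₃ B₃' a₀ a₁))) (hl : -bl * γ ^ 2 ≤ 3) (hβ' : β' * γ ^ 2 ≤ 3 / 4),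
      ∃ γ₁₂ : ℝ, 0 < γ₁₂ ∧ ∃ lamW : ResidW F 2, ∀ P : B12.RunParams, lamW.kSel P < P.K → Step.InInterval γ₁₂ P.K (gOfRecord₁₃ F 2 (theta13OfThm1CCMW F 2 j γ ε₀ ε₂₉ B₃ B₃' a₀ a₁) P) →
        B15Leaf (WOfRecord₁₃ F 2 (theta13OfThm1CCMW F 2 j γ ε₀ ε₂₉ B₃ B₃' a₀ a₁) lamW P) := by
  intro j _ γ ε₀ ε₂₉ B₃ B₃' a₀ a₁ hγ₀ hγh hγe _ _ hB hB' ha₀ ha₁ _ _ _ _ β' _ hbox' _ hβ'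
  exact exists_gamma_residW_b15Leaf_window_theta13OfThm1CCMW_topLevel_pinnedΛΩχZ_of_massLive (lam j γ ε₀ ε₂₉ B₃ B₃' a₀ a₁) (σ j γ ε₀ ε₂₉ B₃ B₃' a₀ a₁) (s j γ ε₀ ε₂₉ B₃ B₃' a₀ a₁) (Nm j γ ε₀ ε₂₉ B₃ B₃' a₀ a₁) (p₁ j γ ε₀ ε₂₉ B₃ B₃' a₀ a₁)
    hγ₀ hγh hB hB' ha₀ ha₁ hbox' hβ' hγe (D j γ ε₀ ε₂₉ B₃ B₃' a₀ a₁) (hDF j γ ε₀ ε₂₉ B₃ B₃' a₀ a₁) (hmassLiveF j γ ε₀ ε₂₉ B₃ B₃' a₀ a₁) (hP1F j γ ε₀ ε₂₉ B₃ B₃' a₀ a₁) (hNNF j γ ε₀ ε₂₉ B₃ B₃' a₀ a₁) (hNkF j γ ε₀ ε₂₉ B₃ B₃' a₀ a₁) (hβ0F j γ ε₀ ε₂₉ B₃ B₃' a₀ a₁) (hβF j γ ε₀ ε₂₉ B₃ B₃' a₀ a₁) (hL₀F j γ ε₀ ε₂₉ B₃ B₃' a₀ a₁)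
    (hL₀LF j γ ε₀ ε₂₉ B₃ B₃' a₀ a₁) (hOBF j γ ε₀ ε₂₉ B₃ B₃' a₀ a₁) (hδF j γ ε₀ ε₂₉ B₃ B₃' a₀ a₁) (hCF j γ ε₀ ε₂₉ B₃ B₃' a₀ a₁) (hβhistF j γ ε₀ ε₂₉ B₃ B₃' a₀ a₁) (hMlF j γ ε₀ ε₂₉ B₃ B₃' a₀ a₁) (hΛF j γ ε₀ ε₂₉ B₃ B₃' a₀ a₁) (L91hF j γ ε₀ ε₂₉ B₃ B₃' a₀ a₁) (L95F j γ ε₀ ε₂₉ B₃ B₃' a₀ a₁) (L91F j γ ε₀ ε₂₉ B₃ B₃' a₀ a₁) (L97F j γ ε₀ ε₂₉ B₃ B₃' a₀ a₁) (L80F j γ ε₀ ε₂₉ B₃ B₃' a₀ a₁)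

end WindowRoadFamily

end Summit.QuantumFields.YangMills.BalabanUVNodes.N12AtTheta13OfThm1CCMWGenericDoorWindowGuard

end
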